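import Literature.Computability.Complexity.CNFToCMMSA
import Literature.Computability.Complexity.PCPSubsetNP
import Literature.Computability.Complexity.CoinCounting
import HarnessLib

/-!
# A PCP verifier's checks as constant-gap CMMSA of constant degree

Topic `Computability/Complexity`. The PCP theorem (`pcp_theorem_exact`, Arora–Barak 2009, Thm. 11.5)
hands every `NP` language a nonadaptive verifier reading `q = O(1)` proof bits on
`r = c log₂ n + c` coins. Its `2^r` checks form a constraint system over the proof positions, and
the Dinur–Safra embedding used by Hirahara (proof of Thm. 5.2, p. 17: literals `L_{x,a}` weighing the
number of constraints on `x`, one monotone DNF `⋁_{accepting views} ⋀ L_{x,a}` per constraint) turns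
it into a CMMSA instance (Hirahara 2022, Def. 5.1) of degree `≤ 2^q · q` and soundness `1`. Over the
BINARY alphabet the list-decoding analysis of Dinur–Safra is too lossy; instead (the analysis of the
hitting-set instances of Alekhnovich–Buss–Moran–Pitassi 2001, §2, proof of Thm. 3, "approximation of
MMSA within factor 2"): an all-satisfying assignment of weight `≤ g · Q` (`Q` = total number of
queries) sets both values on a set `D` of positions with `occ(D) ≤ (g - 1) Q ≤ (g - 1) q 2^r`, and
reading one value elsewhere gives a proof accepted on every coin string not querying `D` — more
than half of them once `(g - 1) q < 1/2`. Hence the gap `gapQ q = 1 + 1/(4q + 4)`.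

* `PCPToCMMSA.coinStrings m` — `{0,1}^m` enumerated by value (`PCPExact.coinStr`), with
  `countP_coinStrings` (`= cnt m E`, the numerator of `uniformProb`);
* `PCPToCMMSA.toCMMSA V x m` — the instance of input `x` for the verifier `V` run with `m` coins;
  `wellFormed_toCMMSA`, `degree_toCMMSA_le`;
* `PCPToCMMSA.toCMMSA_mem_yesSet` — completeness (`Pr[accept] = 1` gives a weight-`Q`
  all-satisfying assignment);
* `PCPToCMMSA.toCMMSA_mem_noSet` — soundness (`Pr[accept] ≤ 1/2` for all proofs gives a
  no-instance at gap `gapQ q`).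

* `PCPToCMMSA.mOf c x = c log₂|x| + c`, `budget`, `formulaT`, `instT` (`instT_eq`) — the data the
  machine of `PCPToCMMSAMachine.lean` computes (the enumeration of answer vectors cut at `2^q`, which
  is all of them for a `q`-query verifier).

The polynomial-time implementation and the NP-hardness of `gapCMMSA (gapQ q) 1 (2^q·q)` from
`pcp_theorem_exact` are in `PCPToCMMSAMachine.lean`.

## References

* S. Arora, B. Barak, *Computational Complexity: A Modern Approach*, CUP 2009, Def. 11.4, Thm. 11.5,
  Thm. 11.9 and §11.3 (PCP theorem ⇔ gap-CSP hardness) [AroraBarakCC2009].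
* S. Hirahara, *NP-hardness of learning programs and partial MCSP*, ECCC TR22-119, Def. 5.1 and
  proof of Thm. 5.2 (pp. 16–17) [Hirahara2022PartialMCSP].
* M. Alekhnovich, S. Buss, S. Moran, T. Pitassi, *Minimum propositional proof length is NP-hard to
  linearly approximate*, J. Symbolic Logic 66 (2001), §2 [AlekhnovichEtAl2001].
-/

namespace Literature.Computability.Complexity

open _root_.Computability MetaComplexity CNFToCMMSA

namespace PCPToCMMSA

/-! ### All coin strings of a length -/

/-- `{0,1}^m`, enumerated as the coin strings `ρ₀, …, ρ_{2^m - 1}` (the `m` low-order bits of the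
index). [cite: AroraBarakCC2009, Remark 11.6(3) (enumerate all 2^{r(n)} coin strings)] -/
def coinStrings (m : ℕ) : List (List Bool) :=
  (List.range (2 ^ m)).map (PCPExact.coinStr m)

/-- `|coinStrings m| = 2^m`. [folklore] -/
@[simp] theorem length_coinStrings (m : ℕ) : (coinStrings m).length = 2 ^ m := by
  simp [coinStrings]

/-- Members of `coinStrings m` have length `m`. [folklore] -/
theorem length_of_mem_coinStrings {m : ℕ} {ρ : List Bool} (h : ρ ∈ coinStrings m) : ρ.length = m := by
  unfold coinStrings at h
  obtain ⟨i, -, rfl⟩ := List.mem_map.1 h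
  exact PCPExact.length_coinStr m i

/-- Every string of length `m` is in `coinStrings m`. [folklore] -/
theorem mem_coinStrings {m : ℕ} {ρ : List Bool} (h : ρ.length = m) : ρ ∈ coinStrings m := by
  unfold coinStrings
  refine List.mem_map.2 ⟨bitsToNat ρ, List.mem_range.2 (h ▸ bitsToNat_lt ρ), ?_⟩
  rw [← h, PCPExact.coinStr_bitsToNat]

/-- The value of the `i`-th coin string is `i` (`i < 2^m`). [folklore] -/
theorem bitsToNat_coinStr {m i : ℕ} (hi : i < 2 ^ m) : bitsToNat (PCPExact.coinStr m i) = i := by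
  have hlen : (encodeNat i).length ≤ m := by
    rw [TM2Pass.length_encodeNat_eq_size]
    exact Nat.size_le.2 hi
  unfold PCPExact.coinStr
  rw [PCPExact.takeD_of_length_le false m _ hlen, bitsToNat_append, bitsToNat_replicate_false,
    mul_zero, add_zero, bitsToNat_encodeNat]

/-- `coinStrings m` has no duplicates. [folklore] -/
theorem nodup_coinStrings (m : ℕ) : (coinStrings m).Nodup := by
  unfold coinStrings
  refine List.Nodup.map_on (fun i hi j hj hij => ?_) (List.nodup_range)
  rw [← bitsToNat_coinStr (List.mem_range.1 hi), ← bitsToNat_coinStr (List.mem_range.1 hj)]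
  exact congrArg bitsToNat hij

/-- **Counting over `coinStrings` is `cnt`**: the number of coin strings of length `m` in an event.
[cite: AroraBarakCC2009, §7.1 (Pr_{r ∈ {0,1}^m})] -/
theorem countP_coinStrings (m : ℕ) (E : Set (List Bool)) [DecidablePred (· ∈ E)] :
    (coinStrings m).countP (fun ρ => decide (ρ ∈ E)) = cnt m E := by
  classical
  rw [List.countP_eq_length_filter]
  have hnd : ((coinStrings m).filter fun ρ => decide (ρ ∈ E)).Nodup := (nodup_coinStrings m).filter _
  rw [← List.toFinset_card_of_nodup hnd]
  unfold cnt
  rw [Finset.filter_congr_decidable]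
  symm
  refine Finset.card_bij' (fun r _ => r.toList) (fun ρ hρ => ⟨ρ, ?_⟩) (fun r hr => ?_) (fun ρ hρ => ?_)
    (fun r _ => by simp) (fun ρ _ => rfl)
  · rw [List.mem_toFinset, List.mem_filter] at hρ
    exact length_of_mem_coinStrings hρ.1
  · rw [Finset.mem_filter] at hr
    rw [List.mem_toFinset, List.mem_filter]
    exact ⟨mem_coinStrings r.toList_length, by simpa using hr.2⟩
  · rw [List.mem_toFinset, List.mem_filter] at hρ
    simpa using hρ.2

/-! ### The construction -/

section Construction

variable (V : PCPVerifier) (x : List Bool) (m : ℕ)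

/-- The query lists of all coin strings. [cite: AroraBarakCC2009, Def. 11.4 (queries)] -/
def queryLists : List (List ℕ) :=
  (coinStrings m).map (V.queries x)

/-- The list of all query occurrences (length `Q`, the total number of queries). [folklore] -/
def posList : List ℕ :=
  (queryLists V x m).flatten

/-- The term of an answer vector `a` to the queries `qs`: the variables `x_{u(p), a_p}`.
[cite: Hirahara2022PartialMCSP, proof of Thm. 5.2 (the terms ⋀_{x ∈ dom r} L_{x, r(x)})] -/
def termOf (Pos : List ℕ) (qs : List ℕ) (a : List Bool) : List ℕ :=
  (qs.zip a).map (litVar Pos)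

/-- The accepting answer vectors on coin string `ρ`. [cite: AroraBarakCC2009, Def. 11.4 (decide)] -/
def accVecs (ρ : List Bool) : List (List Bool) :=
  (coinStrings (V.queries x ρ).length).filter fun a => V.decide x ρ a

/-- The formula of a coin string: `⋁_{accepting a} ⋀ x_{u(p), a_p}`. [cite: Hirahara2022PartialMCSP, proof of Thm. 5.2 (φⱼ = ⋁_{r ∈ Cⱼ⁻¹(1)} ⋀ L_{x,r(x)})] -/
def formulaOf (Pos : List ℕ) (ρ : List Bool) : MonotoneDNF :=
  (accVecs V x ρ).map (termOf Pos (V.queries x ρ))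

/-- **The CMMSA instance of the input `x` for the verifier `V` run with `m` coins**: variables
`x_{u,b}` (`u < Q`), one formula per coin string, occurrence weights, threshold `Q`.
[cite: Hirahara2022PartialMCSP, proof of Thm. 5.2 (pp. 16–17); AlekhnovichEtAl2001, §2] -/
def toCMMSA : CMMSAInstance :=
  ⟨2 * (posList V x m).length, (coinStrings m).map (formulaOf V x (posList V x m)),
    weights (posList V x m), (posList V x m).length⟩

end Construction

/-- The gap `1 + 1/(4q + 4)` for `q`-query verifiers. [cite: AlekhnovichEtAl2001, §2 (proof of Thm. 3: a constant factor)] -/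
noncomputable def gapQ (q : ℕ) : ℝ :=
  1 + 1 / (4 * q + 4)

/-- `1 < gapQ q`. [folklore] -/
theorem one_lt_gapQ (q : ℕ) : 1 < gapQ q := by
  unfold gapQ
  have : (0 : ℝ) < 4 * q + 4 := by positivity
  have := one_div_pos.2 this
  linarith

/-- `1 ≤ gapQ q`. [folklore] -/
theorem one_le_gapQ (q : ℕ) : 1 ≤ gapQ q := (one_lt_gapQ q).le

/-! ### Elementary facts -/

section Facts

variable {V : PCPVerifier} {x : List Bool} {m : ℕ}

/-- A query of a coin string of length `m` occurs in `posList`. [folklore] -/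
theorem mem_posList {ρ : List Bool} (hρ : ρ ∈ coinStrings m) {p : ℕ} (hp : p ∈ V.queries x ρ) :
    p ∈ posList V x m :=
  List.mem_flatten.2 ⟨V.queries x ρ, List.mem_map.2 ⟨ρ, hρ, rfl⟩, hp⟩

/-- `Q ≤ q · 2^m` for a `q`-query verifier. [folklore] -/
theorem length_posList_le {q : ℕ} (hq : ∀ ρ, (V.queries x ρ).length ≤ q) :
    (posList V x m).length ≤ q * 2 ^ m := by
  unfold posList queryLists
  rw [List.length_flatten, List.map_map]
  calc ((coinStrings m).map (List.length ∘ V.queries x)).sum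
      ≤ ((coinStrings m).map (List.length ∘ V.queries x)).length • q :=
        List.sum_le_card_nsmul _ _ fun k hk => by
          obtain ⟨ρ, -, rfl⟩ := List.mem_map.1 hk
          exact hq ρ
    _ = q * 2 ^ m := by rw [List.length_map, length_coinStrings, smul_eq_mul, mul_comm]

/-- Accepting vectors have the length of the query list and are accepted. [folklore] -/
theorem mem_accVecs_iff {ρ : List Bool} {a : List Bool} :
    a ∈ accVecs V x ρ ↔ a.length = (V.queries x ρ).length ∧ V.decide x ρ a = true := by
  unfold accVecs
  rw [List.mem_filter]
  exact ⟨fun h => ⟨length_of_mem_coinStrings h.1, h.2⟩, fun h => ⟨mem_coinStrings h.1, h.2⟩⟩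

/-- Zipping a list with its own image. [folklore] -/
theorem zip_map_self {α β : Type} (f : α → β) : ∀ l : List α, l.zip (l.map f) = l.map fun a => (a, f a)
  | [] => rfl
  | a :: l => by rw [List.map_cons, List.zip_cons_cons, zip_map_self f l, List.map_cons]

/-- In a zip of lists of equal length every item of the left list is paired. [folklore] -/
theorem exists_mem_zip {α β : Type} : ∀ {l : List α} {l' : List β}, l.length = l'.length →
    ∀ a ∈ l, ∃ b, (a, b) ∈ l.zip l'
  | [], _, _, a, ha => by simp at ha
  | _ :: _, [], h, _, _ => by simp at h
  | a' :: l, b' :: l', h, a, ha => by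
    rcases List.mem_cons.1 ha with rfl | ha
    · exact ⟨b', by simp⟩
    · obtain ⟨b, hb⟩ := exists_mem_zip (by simpa using h) a ha
      exact ⟨b, List.mem_cons_of_mem _ hb⟩

/-- Membership in the formulas of `toCMMSA`. [folklore] -/
theorem mem_formulas_iff (ψ : MonotoneDNF) :
    ψ ∈ (toCMMSA V x m).formulas ↔ ∃ ρ ∈ coinStrings m, formulaOf V x (posList V x m) ρ = ψ := by
  show ψ ∈ (coinStrings m).map _ ↔ _
  rw [List.mem_map]

/-- The literal count of the formula of a coin string is at most `2^q · q`. [cite: Hirahara2022PartialMCSP, Def. 5.1 (degree)] -/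
theorem numLiterals_formulaOf_le {q : ℕ} (hq : ∀ ρ, (V.queries x ρ).length ≤ q) (Pos : List ℕ)
    (ρ : List Bool) : (formulaOf V x Pos ρ).numLiterals ≤ 2 ^ q * q := by
  unfold formulaOf MonotoneDNF.numLiterals
  rw [List.map_map]
  set k := (V.queries x ρ).length with hk
  have hkq : k ≤ q := hq ρ
  calc ((accVecs V x ρ).map (List.length ∘ termOf Pos (V.queries x ρ))).sum
      ≤ ((accVecs V x ρ).map (List.length ∘ termOf Pos (V.queries x ρ))).length • q :=
        List.sum_le_card_nsmul _ _ fun n hn => by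
          obtain ⟨a, -, rfl⟩ := List.mem_map.1 hn
          simp only [Function.comp_apply, termOf, List.length_map, List.length_zip]
          exact (min_le_left _ _).trans hkq
    _ ≤ 2 ^ q * q := by
        rw [List.length_map, smul_eq_mul]
        refine Nat.mul_le_mul_right _ ?_
        unfold accVecs
        refine (List.length_filter_le _ _).trans ?_
        rw [length_coinStrings]
        exact Nat.pow_le_pow_right two_pos hkq

/-- **`toCMMSA V x m` is well formed.** [folklore] -/
theorem wellFormed_toCMMSA : (toCMMSA V x m).WellFormed := by
  refine ⟨length_weights _, fun ψ hψ t ht i hi => ?_⟩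
  show i < 2 * (posList V x m).length
  obtain ⟨ρ, hρ, rfl⟩ := (mem_formulas_iff ψ).1 hψ
  unfold formulaOf at ht
  obtain ⟨a, -, rfl⟩ := List.mem_map.1 ht
  unfold termOf at hi
  obtain ⟨pb, hpb, rfl⟩ := List.mem_map.1 hi
  have hp : pb.1 ∈ V.queries x ρ := (List.of_mem_zip hpb).1
  exact litVar_lt (mem_posList hρ hp)

/-- **`toCMMSA V x m` has degree `≤ 2^q · q` for a `q`-query verifier.** [cite: Hirahara2022PartialMCSP, Def. 5.1 (degree)] -/
theorem degree_toCMMSA_le {q : ℕ} (hq : ∀ ρ, (V.queries x ρ).length ≤ q) :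
    (toCMMSA V x m).degree ≤ 2 ^ q * q := by
  rw [CMMSAInstance.degree_le_iff]
  intro ψ hψ
  obtain ⟨ρ, -, rfl⟩ := (mem_formulas_iff ψ).1 hψ
  exact numLiterals_formulaOf_le hq _ ρ

/-- The occurrence weight of `u`, coin string by coin string. [folklore] -/
theorem occW_posList (u : ℕ) :
    occW (posList V x m) u = ((queryLists V x m).map fun qs =>
      qs.countP fun p => decide (firstIdx p (posList V x m) = u)).sum := by
  unfold occW
  conv_lhs => rw [show posList V x m = (queryLists V x m).flatten from rfl]
  rw [List.countP_flatten]
  rfl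

end Facts

/-! ### Completeness -/

/-- **Completeness**: if some proof is accepted with probability `1` (on `m = coins |x|` coins), the
instance is a yes-instance of degree `≤ 2^q · q` — the indicator of the proof weighs exactly `Q` and
satisfies the formula of every coin string through the term of the honest answers.
[cite: Hirahara2022PartialMCSP, proof of Thm. 5.2 (completeness, p. 17); AroraBarakCC2009, Thm. 11.9 (proof)] -/
theorem toCMMSA_mem_yesSet {V : PCPVerifier} {x : List Bool} {m q : ℕ} (hq : ∀ ρ, (V.queries x ρ).length ≤ q)
    (hm : V.coins x.length = m) (h : ∃ π, V.acceptProb x π = 1) :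
    toCMMSA V x m ∈ CMMSA.yesSet fun _ => 2 ^ q * q := by
  obtain ⟨π, hπ⟩ := h
  set Pos := posList V x m with hPos
  have hall : ∀ ρ : List Bool, ρ.length = m → V.accepts x π ρ = true := by
    intro ρ hρ
    have h1 : uniformProb m {ρ | V.accepts x π ρ = true} = 1 := by rw [← hm]; exact hπ
    exact PCPExact.forall_of_uniformProb_eq_one h1 ρ hρ
  refine ⟨wellFormed_toCMMSA, degree_toCMMSA_le hq, yesAssign Pos π, ?_, fun ψ hψ => ?_⟩
  · -- weight exactly `Q`
    rw [weightOf_of_weights (Pos := Pos) rfl rfl]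
    show _ ≤ Pos.length
    calc ∑ u ∈ Finset.range Pos.length,
          occW Pos u * ((if yesAssign Pos π (2 * u) then 1 else 0) + (if yesAssign Pos π (2 * u + 1) then 1 else 0))
        = ∑ u ∈ Finset.range Pos.length, occW Pos u := Finset.sum_congr rfl fun u _ => by
          rw [yesAssign_even, yesAssign_odd]
          cases π (Pos.getD u 0) <;> simp
      _ = Pos.length := sum_occW Pos
      _ ≤ Pos.length := le_rfl
  · obtain ⟨ρ, hρ, rfl⟩ := (mem_formulas_iff ψ).1 hψ
    have hρm : ρ.length = m := length_of_mem_coinStrings hρ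
    set qs := V.queries x ρ with hqs
    -- the honest answers are accepting
    have hacc : qs.map π ∈ accVecs V x ρ := by
      rw [mem_accVecs_iff]
      refine ⟨by rw [List.length_map], ?_⟩
      have := hall ρ hρm
      unfold PCPVerifier.accepts at this
      exact this
    rw [MonotoneDNF.eval_eq_true_iff]
    refine ⟨termOf Pos qs (qs.map π), List.mem_map.2 ⟨_, hacc, rfl⟩, fun i hi => ?_⟩
    unfold termOf at hi
    rw [zip_map_self, List.map_map] at hi
    obtain ⟨p, hp, rfl⟩ := List.mem_map.1 hi
    simp only [Function.comp_apply]
    rw [yesAssign_litVar π (show (p, π p).1 ∈ Pos by rw [hPos]; exact mem_posList hρ hp)]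
    simp [Literal.eval]

/-! ### Soundness -/

/-- **Soundness**: if every proof is accepted with probability `≤ 1/2` (on `m = coins |x|` coins),
the instance is a no-instance at gap `gapQ q`, soundness `1`, degree `2^q · q`.
[cite: AlekhnovichEtAl2001, §2 (proof of Thm. 3); AroraBarakCC2009, Thm. 11.9 (proof); Hirahara2022PartialMCSP, proof of Thm. 5.2 (soundness, pp. 17–18)] -/
theorem toCMMSA_mem_noSet {V : PCPVerifier} {x : List Bool} {m q : ℕ} (hq : ∀ ρ, (V.queries x ρ).length ≤ q)
    (hm : V.coins x.length = m) (h : ∀ π, V.acceptProb x π ≤ 1 / 2) :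
    toCMMSA V x m ∈ CMMSA.noSet (fun _ => gapQ q) (fun _ => 1) fun _ => 2 ^ q * q := by
  refine ⟨wellFormed_toCMMSA, degree_toCMMSA_le hq, fun a ha => ?_⟩
  rw [real_satCount_lt_one_iff]
  set Pos := posList V x m with hPos
  set N := Pos.length with hN
  -- suppose every formula holds
  by_contra hne
  push Not at hne
  have hall : ∀ ψ ∈ (toCMMSA V x m).formulas, ψ.eval a = true := fun ψ hψ => by
    cases hψa : ψ.eval a
    · exact absurd hψa (hne ψ hψ)
    · rfl
  -- an accepting, realised answer vector per coin string
  have hsat : ∀ ρ ∈ coinStrings m, ∃ v ∈ accVecs V x ρ,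
      ∀ pb ∈ (V.queries x ρ).zip v, a (litVar Pos pb) = true := by
    intro ρ hρ
    have h1 := hall _ ((mem_formulas_iff _).2 ⟨ρ, hρ, rfl⟩)
    rw [MonotoneDNF.eval_eq_true_iff] at h1
    obtain ⟨T, hT, hTa⟩ := h1
    obtain ⟨v, hv, rfl⟩ := List.mem_map.1 hT
    exact ⟨v, hv, fun pb hpb => hTa _ (List.mem_map.2 ⟨pb, hpb, rfl⟩)⟩
  -- every queried position carries a value
  have hassigned : ∀ p ∈ Pos, a (2 * firstIdx p Pos) = true ∨ a (2 * firstIdx p Pos + 1) = true := by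
    intro p hp
    have hp' : p ∈ (queryLists V x m).flatten := by rw [hPos] at hp; exact hp
    obtain ⟨qs, hqs, hpqs⟩ := List.mem_flatten.1 hp'
    unfold queryLists at hqs
    obtain ⟨ρ, hρ, rfl⟩ := List.mem_map.1 hqs
    obtain ⟨v, hv, hva⟩ := hsat ρ hρ
    obtain ⟨b, hb⟩ := exists_mem_zip (mem_accVecs_iff.1 hv).1.symm p hpqs
    have := hva _ hb
    unfold litVar at this
    cases b
    · left; simpa using this
    · right; simpa using this
  -- the doubly-set positions
  set D : Finset ℕ := (Finset.range N).filter fun u => a (2 * u) = true ∧ a (2 * u + 1) = true with hD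
  -- the weight bound `N + occ(D) ≤ w(a)`
  have hWge : N + ∑ u ∈ D, occW Pos u ≤ (toCMMSA V x m).weightOf a := by
    rw [weightOf_of_weights (Pos := Pos) rfl rfl, hD, Finset.sum_filter]
    calc N + ∑ u ∈ Finset.range N, (if a (2 * u) = true ∧ a (2 * u + 1) = true then occW Pos u else 0)
        = ∑ u ∈ Finset.range N, (occW Pos u + if a (2 * u) = true ∧ a (2 * u + 1) = true then occW Pos u else 0) := by
          rw [Finset.sum_add_distrib, sum_occW]
      _ ≤ _ := Finset.sum_le_sum fun u hu => ?_
    by_cases h0 : occW Pos u = 0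
    · simp [h0]
    · -- `u` is the first index of a queried position
      obtain ⟨p, hp, hpu⟩ : ∃ p ∈ Pos, firstIdx p Pos = u := by
        have hpos : 0 < Pos.countP fun v => decide (firstIdx v Pos = u) := Nat.pos_of_ne_zero h0
        obtain ⟨p, hp, hpu⟩ := List.countP_pos_iff.1 hpos
        exact ⟨p, hp, by simpa using hpu⟩
      have hass := hassigned p hp
      rw [hpu] at hass
      by_cases ha0 : a (2 * u) = true
      · by_cases ha1 : a (2 * u + 1) = true
        · simp [ha0, ha1, mul_two]
        · simp [ha0, ha1]
      · by_cases ha1 : a (2 * u + 1) = true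
        · simp [ha0, ha1]
        · exact absurd hass (by simp [ha0, ha1])
  -- hence `occ(D) ≤ (g - 1) N ≤ (g - 1) q 2^m`
  have hNq : N ≤ q * 2 ^ m := length_posList_le hq
  have hoccD : (∑ u ∈ D, (occW Pos u : ℝ)) ≤ (gapQ q - 1) * (q * 2 ^ m) := by
    have ha' : ((toCMMSA V x m).weightOf a : ℝ) ≤ gapQ q * N := ha
    have hWge' : ((N + ∑ u ∈ D, occW Pos u : ℕ) : ℝ) ≤ (toCMMSA V x m).weightOf a := by exact_mod_cast hWge
    push_cast at hWge'
    have hg1 : 0 ≤ gapQ q - 1 := by linarith [one_lt_gapQ q]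
    have hNq' : (N : ℝ) ≤ q * 2 ^ m := by exact_mod_cast hNq
    nlinarith [mul_le_mul_of_nonneg_left hNq' hg1]
  -- the proof read off the odd variables, and the touching coin strings
  set π : ℕ → Bool := fun p => a (2 * firstIdx p Pos + 1) with hπ
  set touch : List Bool → Bool := fun ρ => (V.queries x ρ).any fun p => decide (firstIdx p Pos ∈ D) with htouch
  -- a coin string not touching `D` accepts `π`
  have haccept : ∀ ρ ∈ coinStrings m, touch ρ = false → V.accepts x π ρ = true := by
    intro ρ hρ hnt
    obtain ⟨v, hv, hva⟩ := hsat ρ hρ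
    obtain ⟨hvlen, hvdec⟩ := mem_accVecs_iff.1 hv
    set qs := V.queries x ρ with hqs
    -- `v` is the vector of honest answers
    have hvπ : v = qs.map π := by
      refine List.ext_getElem (by rw [List.length_map, hvlen]) fun j h1 h2 => ?_
      rw [List.getElem_map]
      have hj : j < qs.length := by simpa using h2
      have hmem : (qs[j], v[j]) ∈ qs.zip v := by
        have hz : j < (qs.zip v).length := by rw [List.length_zip, hvlen, min_self]; exact hj
        have := List.getElem_mem hz
        rwa [List.getElem_zip] at this
      have hal : a (litVar Pos (qs[j], v[j])) = true := hva _ hmem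
      set u := firstIdx qs[j] Pos with hu
      have huN : u < N := firstIdx_lt_length (mem_posList hρ (List.getElem_mem hj))
      have huD : u ∉ D := by
        intro huD
        have : touch ρ = true := List.any_eq_true.2 ⟨qs[j], List.getElem_mem hj, by simpa [← hu] using huD⟩
        rw [this] at hnt
        exact Bool.noConfusion hnt
      have hnotBoth : ¬ (a (2 * u) = true ∧ a (2 * u + 1) = true) := fun hb =>
        huD (Finset.mem_filter.2 ⟨Finset.mem_range.2 huN, hb⟩)
      show v[j] = a (2 * firstIdx qs[j] Pos + 1)
      rw [← hu]
      cases hvj : v[j]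
      · have h0 : a (2 * u) = true := by simpa [litVar, ← hu, hvj] using hal
        cases h1' : a (2 * u + 1)
        · rfl
        · exact absurd ⟨h0, h1'⟩ hnotBoth
      · have h1' : a (2 * u + 1) = true := by simpa [litVar, ← hu, hvj] using hal
        rw [h1']
    unfold PCPVerifier.accepts
    rw [← hqs, ← hvπ]
    exact hvdec
  -- counting: every coin string accepts or touches
  have hcount1 : 2 ^ m ≤ (coinStrings m).countP (fun ρ => V.accepts x π ρ) + (coinStrings m).countP touch := by
    rw [← length_coinStrings m, List.length_eq_countP_add_countP (p := touch) (l := coinStrings m), Nat.add_comm]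
    refine Nat.add_le_add_right (List.countP_mono_left fun ρ hρ hnt => haccept ρ hρ ?_) _
    simpa using hnt
  -- `#touching ≤ occ(D)`
  have hcount2 : (coinStrings m).countP touch ≤ ∑ u ∈ D, occW Pos u := by
    have hocc : ∀ u, occW Pos u = ((queryLists V x m).map fun qs =>
        qs.countP fun p => decide (firstIdx p Pos = u)).sum := fun u => by rw [hPos]; exact occW_posList u
    simp only [hocc]
    rw [finset_sum_list_sum, countP_eq_sum_map]
    unfold queryLists
    rw [List.map_map]
    refine sum_map_le_sum_map fun ρ _ => ?_
    simp only [Function.comp_apply]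
    split_ifs with hC
    · obtain ⟨p, hp, hpD⟩ := List.any_eq_true.1 hC
      have hpD' : firstIdx p Pos ∈ D := by simpa using hpD
      refine le_trans ?_ (Finset.single_le_sum (fun u _ => Nat.zero_le _) hpD')
      exact List.countP_pos_iff.2 ⟨p, hp, by simp⟩
    · exact Nat.zero_le _
  -- the soundness bound: `#accepting ≤ 2^m / 2`
  have hcount3 : (2 : ℝ) * (coinStrings m).countP (fun ρ => V.accepts x π ρ) ≤ 2 ^ m := by
    have hE : (coinStrings m).countP (fun ρ => V.accepts x π ρ) = cnt m {ρ | V.accepts x π ρ = true} := by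
      rw [← countP_coinStrings m {ρ | V.accepts x π ρ = true}]
      exact List.countP_congr fun ρ _ => by simp
    have hπ2 := h π
    rw [PCPVerifier.acceptProb, hm, uniformProb_eq_cnt_div, div_le_iff₀ (by positivity)] at hπ2
    rw [hE]
    linarith
  -- contradiction
  have h1 : ((2 ^ m : ℕ) : ℝ) ≤ (coinStrings m).countP (fun ρ => V.accepts x π ρ) + (coinStrings m).countP touch := by
    exact_mod_cast hcount1
  have h2 : ((coinStrings m).countP touch : ℝ) ≤ ∑ u ∈ D, (occW Pos u : ℝ) := by exact_mod_cast hcount2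
  push_cast at h1
  have hpow : (0 : ℝ) < 2 ^ m := by positivity
  have hgq : (gapQ q - 1) * q ≤ 1 / 4 := by
    unfold gapQ
    have hq0 : (0 : ℝ) ≤ q := Nat.cast_nonneg _
    rw [add_sub_cancel_left, div_mul_eq_mul_div, one_mul, div_le_div_iff₀ (by positivity) (by norm_num)]
    linarith
  nlinarith [mul_le_mul_of_nonneg_right hgq hpow.le]

/-! ### The data of the machine -/

/-- The coin count `m(x) = c log₂|x| + c`. [cite: AroraBarakCC2009, Thm. 11.5 (r(n) = O(log n))] -/
def mOf (c : ℕ) (x : List Bool) : ℕ := c * Nat.log 2 x.length + c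

/-- The unary budget `2^c (|x|+1)^c ≥ 2^{m(x)}` for the enumeration of the coin strings. [folklore] -/
def budget (c : ℕ) (x : List Bool) : ℕ := 2 ^ c * (x.length + 1) ^ c

/-- `2^{⌊log₂ n⌋} ≤ n + 1`. [folklore] -/
theorem two_pow_log_le_succ (n : ℕ) : 2 ^ Nat.log 2 n ≤ n + 1 := by
  rcases Nat.eq_zero_or_pos n with rfl | hn
  · simp
  · exact (Nat.pow_log_le_self 2 hn.ne').trans (Nat.le_succ n)

/-- `2^{m(x)} ≤ budget`. [folklore] -/
theorem two_pow_mOf_le (c : ℕ) (x : List Bool) : 2 ^ mOf c x ≤ budget c x := by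
  unfold mOf budget
  rw [pow_add, mul_comm c, pow_mul, mul_comm]
  exact Nat.mul_le_mul_left _ (Nat.pow_le_pow_left (two_pow_log_le_succ _) c)

/-- `map` of a `zip` as a `zipWith`. [folklore] -/
theorem map_zip_eq_zipWith {α β γ : Type} (f : α × β → γ) : ∀ (l : List α) (l' : List β),
    (l.zip l').map f = List.zipWith (fun a b => f (a, b)) l l'
  | [], _ => by simp
  | _ :: _, [] => by simp
  | a :: l, b :: l' => by rw [List.zip_cons_cons, List.map_cons, List.zipWith_cons_cons, map_zip_eq_zipWith f l l']

/-- The formula of a coin string as the machine computes it, on data `((x, Pos), ρ)`: the enumeration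
of the answer vectors is cut at `2^q`. [cite: Hirahara2022PartialMCSP, proof of Thm. 5.2 (φⱼ)] -/
def formulaT (V : PCPVerifier) (q : ℕ) (x : List Bool) (Pos : List ℕ) (ρ : List Bool) : MonotoneDNF :=
  (((List.range (min (2 ^ (V.queries x ρ).length) (2 ^ q))).map
      (PCPExact.coinStr (V.queries x ρ).length)).filter (V.decide x ρ)).map
    fun a => List.zipWith (fun p b => litVar Pos (p, b)) (V.queries x ρ) a

/-- Below `q` queries `formulaT` is `formulaOf`. [folklore] -/
theorem formulaT_eq {V : PCPVerifier} {q : ℕ} {x : List Bool} (Pos : List ℕ) {ρ : List Bool}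
    (hq : (V.queries x ρ).length ≤ q) : formulaT V q x Pos ρ = formulaOf V x Pos ρ := by
  unfold formulaT formulaOf accVecs coinStrings termOf
  rw [min_eq_left (Nat.pow_le_pow_right two_pos hq)]
  refine List.map_congr_left fun a _ => ?_
  rw [map_zip_eq_zipWith]

/-- The instance tuple `(2Q, formulas, weights, Q)` the machine outputs on input `x`. [cite: Hirahara2022PartialMCSP, proof of Thm. 5.2; AroraBarakCC2009, Thm. 11.9] -/
def instT (V : PCPVerifier) (c q : ℕ) (x : List Bool) : ℕ × List (List (List ℕ)) × List ℕ × ℕ :=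
  (2 * (posList V x (mOf c x)).length,
    (coinStrings (mOf c x)).map (formulaT V q x (posList V x (mOf c x))),
    weights (posList V x (mOf c x)), (posList V x (mOf c x)).length)

/-- For a `q`-query verifier `instT` is the tuple of `toCMMSA V x (m(x))`. [folklore] -/
theorem instT_eq {V : PCPVerifier} {c q : ℕ} (hq : ∀ x ρ, (V.queries x ρ).length ≤ q) (x : List Bool) :
    instT V c q x = (toCMMSA V x (mOf c x)).toTuple := by
  unfold instT toCMMSA CMMSAInstance.toTuple
  simp only [Prod.mk.injEq, true_and, and_true]
  exact List.map_congr_left fun ρ _ => formulaT_eq _ (hq x ρ)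

end PCPToCMMSA

end Literature.Computability.Complexity
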